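import Summits.QuantumFields.YangMills.Theorems.UnitScaleTiltProp7StubEXOfDisplayedRowsWWSE
import Summits.QuantumFields.YangMills.Theorems.UnitScaleTiltProp7StubEXOfDisplayedRowsWWECtr
import Summits.QuantumFields.YangMills.Theorems.UnitScaleTiltProp7ExistRouteAlphaMinGCtr
import HarnessLib

/-!
# Route `UnitScaleTilt`, crux «MinimiserStabilityRegPr» (stmt-QuantumFields-19200, stub EX `stub_existenceMinimalOrbit`), route (α) — **«WWSE-CTR» (T3b of the EX namer's S7′ CTR chain,
# ★★OWNER RULING g28-№7 cure (i)+(ii-a)): ✓`Prop7StubEXOfDisplayedRowsWWSE.stubEX_of_displayedRows_wWSE` VERBATIM with (1) ONE opaque predicate letter `Lift : ∀ (L) (i : Idx L), GaugeField … →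
# Prop` (right after `Lan`), (2) the antecedent `Lift L i U₀ →` inserted right after `CloseAvg … V U₀ →` in the CHART-112ˢ row `hChart` and nowhere else, and (3) ONE new displayed row
# `hSymCentre` = ★px14's (T1) `hS` bytes of record in all-`L` form at `B₃ := 3L` (RULING №7 (ii-a): below a threshold `aS L`, every fibre containing a printed-regular `U₀` contains a printed-
# regular `U₁` carrying the lift), handed to the spine twin (T1), which RE-CENTRES the chart at `U₁`** — proof = v1's lines with ✓∕⧗`…WWECtr` (T3a) and ★px14's ✓∕⧗`…ExistRouteAlphaMinGCtr`
# (T1) by name.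

Cell `ym3-torus` (HUMAN RULING D-0037, YM ladder rung R3 — YM₃ on T³, NOT d = 4, NOT Clay; YM gap NOT proved), width seat `ym3-torus-px16` (gen 2, «px16: WWE∕WWSE∕S3SE-CTR» (T3)+(T4),
EX namer ★w2-19200 g6 S7′ DESIGN 2026-08-28, ★★OWNER ACK 83).  THEOREMS ONLY (0 `def`, 0 `sorry`); `--supports stmt-QuantumFields-19200 --as helper`, count-neutral.  `Lift` is OPAQUE here
(★px14's (T1)(T2) design, EX namer REVIEW PASS 21:59:22Z): the text of record (✓p671435 `hSplitD_of_Y1`'s binder at family letters, sha16 8467e4121a10a649) is substituted only at the display.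
HONEST SCOPE: by-name bookkeeping — the antecedent is passed through, never used here; `hSymCentre` and every analytic input stay DISPLAYED rows; not a proof of the stub; nothing continuum ∕ OS ∕
mass-gap ∕ Clay.

References: T. Bałaban, CMP **102** (1985) 277–309 [Balaban1985Variational] (Prop. 7 p.299, Prop. 6 p.295, (45)–(46) p.285, (112) p.294, (123)–(142) pp.296–299); CMP **98** (1985) 17–51
[Balaban1985RegularSpaces] ((1.37) p.82, Thm 2 p.83); CMP **99** (1985) 389–434 [Balaban1985BackgroundPropagators] ((3.19)–(3.21) pp.393–394: the lifting hypothesis).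
-/

set_option autoImplicit false

noncomputable section

open scoped BigOperators Matrix.Norms.L2Operator Matrix

namespace Summit.QuantumFields.YangMills.Theorems.Prop7StubEXOfDisplayedRowsWWSECtr

open Literature.MathematicalPhysics.QuantumFieldTheory.Balaban1983to89
open Literature.MathematicalPhysics.QuantumFieldTheory.Balaban1983to89.T3ContinuumYM3Torus
open Literature.MathematicalPhysics.QuantumFieldTheory.Balaban1983to89.T3UnitLawDensityEML (ℰp)
open Literature.MathematicalPhysics.QuantumFieldTheory.Balaban1983to89.T3ConstrainedMinimiser (fibre)
open Literature.MathematicalPhysics.QuantumFieldTheory.Balaban1983to89.T3PrintedRegularMinimiser (RegPr regFibrePr)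
open Literature.MathematicalPhysics.QuantumFieldTheory.Balaban1983to89.T3PrintedRegularOrbits (descTransf)
open Literature.MathematicalPhysics.QuantumFieldTheory.Balaban1983to89.T3Thm1Carrier
open Literature.MathematicalPhysics.QuantumFieldTheory.Balaban1983to89.T3SectALandauChart (In19 emb15 CloseAvg eta)
open BlockAveragingEMLLinearisedBackground (pertVar)
open B4Sect5Torus (TSite)
open B9SectCLatticeCarrier (Bond)
open B10Eq27TorusAxialLog (unitsField toUField)
open B11Eq115Space (NegSize Space115)
open B11Eq111FrakG (nabla115)
open B11Eq98CurrentSlot (Jcur)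
open B13Contraction113 (QuadAnalytic)
open B8Thm2SetupTorus (Thm2SetupSUAt)
open B7Prop2SpecialUnitary (specialUnitaryUnits)
open Summit.QuantumFields.YangMills.Theorems.Prop7TPrint (nMax19 expHermField)
open Summit.QuantumFields.YangMills.Theorems.Prop7SPrint (AvgCondPrint AvgCondPrintS NormS IsLandauPrint)
open Summit.QuantumFields.YangMills.Theorems.Prop7CovOfThm2 (cov_of_thm2SetupSUAt)
open Summit.QuantumFields.YangMills.Theorems.Prop7ExistRouteAlphaMinGCtr (existenceMinimalOrbit_of_CminG_covCtr)
open Summit.QuantumFields.YangMills.Theorems.Prop7ClosedFibreHalving (existenceMinimalOrbit_allB₃_of_one)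

/-! ## §1 C-minˢ at `(L, B₃)` with the WINDOWED (1.37)-binder — from ✓`Cmin_of_P6T3_chart_growth_pd_S` at the windowed letter `Bf′` -/

variable {L : ℕ}

/-- ★★ **THE (α-S) DEPMAP OF `stub_existenceMinimalOrbit` WITH THE GROWTH ROW RE-KNIT AT THE CRITICAL BACKGROUND, (B20) WINDOWED, (21)-LETTER GENERIC** (minimiser's
(21) = `Lan L i U₀ X`) — conclusion: the REGISTERED text of `stub_existenceMinimalOrbit` (all `L > 1`, all `B₃ > 4`) VERBATIM; displayed rows N06(d = 3) `norm_G`∕`norm_H₁`,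
Prop. 4 `prop4`, (B20) `bound20` windowed at `B₃* = 3L`, CHART-112ˢ `hChart`, and — replacing `hGrowth` — the opaque slice `Tsl`, CHART_W `hChartW` (Thm 2 + (47) + (5)-invariance
at `W = (e^{iX}U₀)^u`) and LOCMIN_W `hLocW` ((141)–(142): `A(W) ≤ A(e^{iD}W)` on the slice), the Thm 2 sockets `hThm2S` (`Thm2SetupSUAt` currency, v3.2ˢ).  Composition:
✓`cov_of_thm2SetupSUAt` (COV), ✓`Cmin_of_P6T3_chart_locmin_pd_wW`, ✓`existenceMinimalOrbit_of_CminG_cov` (spine), ✓`existenceMinimalOrbit_allB₃_of_one`.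
[cite: Balaban1985Variational, Prop. 7 p.299, Prop. 6 p.295, (112) p.294, (141)-(142) p.299, (47) p.285; Balaban1985RegularSpaces, Thm 2 p.83, (1.37) p.82, (1.28)-(1.30) p.81] -/
theorem stubEX_of_displayedRows_wWSECtr
    [hFL : ∀ F : T3Family, Fact (0 < (F.L : ℝ))] [hFη : ∀ (F : T3Family) (k : ℕ), Fact (0 < ((F.L : ℝ)⁻¹) ^ k)]
    (Lan : ∀ (L : ℕ) (i : Idx L), GaugeField (i.1.1.P i.1.2.2) 0 (Matrix.specialUnitaryGroup (Fin 2) ℂ) → (PBond (i.1.1.P i.1.2.2) 0 → Matrix (Fin 2) (Fin 2) ℂ) → Prop)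
    -- the LIFT antecedent of the S7′ chain, OPAQUE `L`- and member-indexed predicate (like `Lan`; ★px14 (T1)(T2) design, EX namer REVIEW PASS 21:59:22Z; text of record fixed only at the display)
    (Lift : ∀ (L : ℕ) (i : Idx L), GaugeField (i.1.1.P i.1.2.2) 0 (Matrix.specialUnitaryGroup (Fin 2) ℂ) → Prop)
    (Pd : ∀ (L : ℕ) (i : Idx L), Fin (i.1.1.P i.1.2.2).d → ℕ) (e : ∀ (L : ℕ) (i : Idx L), Site (i.1.1.P i.1.2.2) 0 ≃ TSite (i.1.1.P i.1.2.2).d (Pd L i))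
    (he : ∀ (L : ℕ) (i : Idx L) (x : Site (i.1.1.P i.1.2.2) 0) (μ : Fin (i.1.1.P i.1.2.2).d), e L i (x.shift μ) = B9Eq33CovDerivVector.shiftEquiv μ (e L i x))
    -- the constants, member-uniform at each `L` (print: «absolute constants depending on d and L only»)
    (B₀ C₄ a₃ α r M aW : ℕ → ℝ) (hB₀ : ∀ L, 1 < L → 0 < B₀ L) (hC₄ : ∀ L, 1 < L → 0 < C₄ L) (ha₃ : ∀ L, 1 < L → 0 < a₃ L)
    (hα : ∀ L, 1 < L → 0 < α L) (hr : ∀ L, 1 < L → 0 < r L) (haW : ∀ L, 1 < L → 0 < aW L)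
    -- the curved letters, OPAQUE
    (𝒢f : ∀ (L : ℕ) (i : Idx L) (U₀ : GaugeField (i.1.1.P i.1.2.2) 0 (Matrix.specialUnitaryGroup (Fin 2) ℂ)),
      NegSize (i.1.1.L : ℝ) (((i.1.1.L : ℝ)⁻¹) ^ (i.1.2.2 - i.1.2.1)) (fun _ : Bond (i.1.1.P i.1.2.2).d (Pd L i) => i.1.2.2 - i.1.2.1) 3
          (Matrix (Fin 2) (Fin 2) ℂ) →L[ℂ]
        Space115 (i.1.1.L : ℝ) (((i.1.1.L : ℝ)⁻¹) ^ (i.1.2.2 - i.1.2.1)) (fun _ : Bond (i.1.1.P i.1.2.2).d (Pd L i) => i.1.2.2 - i.1.2.1)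
          (fun _ : Bond (i.1.1.P i.1.2.2).d (Pd L i) × Fin (i.1.1.P i.1.2.2).d => i.1.2.2 - i.1.2.1) (nabla115 (((i.1.1.L : ℝ)⁻¹) ^ (i.1.2.2 - i.1.2.1)) (fun b : Bond (i.1.1.P i.1.2.2).d (Pd L i) => unitsField (toUField U₀) ⟨(e L i).symm b.1, b.2⟩)))
    (Wf : ∀ (L : ℕ) (i : Idx L) (U₀ : GaugeField (i.1.1.P i.1.2.2) 0 (Matrix.specialUnitaryGroup (Fin 2) ℂ)),
      Space115 (i.1.1.L : ℝ) (((i.1.1.L : ℝ)⁻¹) ^ (i.1.2.2 - i.1.2.1)) (fun _ : Bond (i.1.1.P i.1.2.2).d (Pd L i) => i.1.2.2 - i.1.2.1)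
          (fun _ : Bond (i.1.1.P i.1.2.2).d (Pd L i) × Fin (i.1.1.P i.1.2.2).d => i.1.2.2 - i.1.2.1) (nabla115 (((i.1.1.L : ℝ)⁻¹) ^ (i.1.2.2 - i.1.2.1)) (fun b : Bond (i.1.1.P i.1.2.2).d (Pd L i) => unitsField (toUField U₀) ⟨(e L i).symm b.1, b.2⟩)) →
        NegSize (i.1.1.L : ℝ) (((i.1.1.L : ℝ)⁻¹) ^ (i.1.2.2 - i.1.2.1)) (fun _ : Bond (i.1.1.P i.1.2.2).d (Pd L i) => i.1.2.2 - i.1.2.1) 3 (Matrix (Fin 2) (Fin 2) ℂ))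
    (β : ∀ L : ℕ, Idx L → Type) [∀ (L : ℕ) (i : Idx L), Fintype (β L i)]
    (H₁f : ∀ (L : ℕ) (i : Idx L) (U₀ : GaugeField (i.1.1.P i.1.2.2) 0 (Matrix.specialUnitaryGroup (Fin 2) ℂ)),
      (β L i → Matrix (Fin 2) (Fin 2) ℂ) →L[ℂ]
        Space115 (i.1.1.L : ℝ) (((i.1.1.L : ℝ)⁻¹) ^ (i.1.2.2 - i.1.2.1)) (fun _ : Bond (i.1.1.P i.1.2.2).d (Pd L i) => i.1.2.2 - i.1.2.1)
          (fun _ : Bond (i.1.1.P i.1.2.2).d (Pd L i) × Fin (i.1.1.P i.1.2.2).d => i.1.2.2 - i.1.2.1) (nabla115 (((i.1.1.L : ℝ)⁻¹) ^ (i.1.2.2 - i.1.2.1)) (fun b : Bond (i.1.1.P i.1.2.2).d (Pd L i) => unitsField (toUField U₀) ⟨(e L i).symm b.1, b.2⟩)))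
    (Bf : ∀ (L : ℕ) (i : Idx L), GaugeField (i.1.1.P i.1.2.1) 0 (Matrix.specialUnitaryGroup (Fin 2) ℂ) → GaugeField (i.1.1.P i.1.2.2) 0 (Matrix.specialUnitaryGroup (Fin 2) ℂ) →
      β L i → Matrix (Fin 2) (Fin 2) ℂ)
    -- the slice at the critical background `W`, OPAQUE (sizes included)
    (Tsl : ∀ (L : ℕ) (i : Idx L), GaugeField (i.1.1.P i.1.2.2) 0 (Matrix.specialUnitaryGroup (Fin 2) ℂ) → Set (PBond (i.1.1.P i.1.2.2) 0 → Matrix (Fin 2) (Fin 2) ℂ))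
    -- their displayed bounds (the `SectEDatum` fields at admissible backgrounds)
    (norm_G : ∀ (L : ℕ), 1 < L → ∀ (i : Idx L) (ρ : ℝ) (U₀ : GaugeField (i.1.1.P i.1.2.2) 0 (Matrix.specialUnitaryGroup (Fin 2) ℂ)),
      RegPr i.1.1 i.1.2.1 i.1.2.2 ρ U₀ → ρ ≤ α L → ∀ f, ‖𝒢f L i U₀ f‖ ≤ B₀ L * ‖f‖)
    (prop4 : ∀ (L : ℕ), 1 < L → ∀ (i : Idx L) (ρ : ℝ) (U₀ : GaugeField (i.1.1.P i.1.2.2) 0 (Matrix.specialUnitaryGroup (Fin 2) ℂ)),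
      RegPr i.1.1 i.1.2.1 i.1.2.2 ρ U₀ → ρ ≤ α L → QuadAnalytic (Wf L i U₀) (C₄ L) (a₃ L))
    (norm_H₁ : ∀ (L : ℕ), 1 < L → ∀ (i : Idx L) (ρ : ℝ) (U₀ : GaugeField (i.1.1.P i.1.2.2) 0 (Matrix.specialUnitaryGroup (Fin 2) ℂ)),
      RegPr i.1.1 i.1.2.1 i.1.2.2 ρ U₀ → ρ ≤ α L → ∀ b, ‖H₁f L i U₀ b‖ ≤ B₀ L * ‖b‖)
    -- (B20), WINDOWED at `B₃* = 3L`: asked only on the admissible class `L³·(3L)·ε₁ ≤ α L`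
    (bound20 : ∀ (L : ℕ), 1 < L → ∀ (i : Idx L) (ε₁ : ℝ) (V : GaugeField (i.1.1.P i.1.2.1) 0 (Matrix.specialUnitaryGroup (Fin 2) ℂ))
      (U₀ : GaugeField (i.1.1.P i.1.2.2) 0 (Matrix.specialUnitaryGroup (Fin 2) ℂ)), 0 < ε₁ → PlaqSmall ε₁ V →
      RegPr i.1.1 i.1.2.1 i.1.2.2 ((L : ℝ) ^ 3 * (3 * (L : ℝ)) * ε₁) U₀ → CloseAvg i.1.1 i.1.2.1 i.1.2.2 i.2.2.le ((L : ℝ) ^ 3 * ε₁) V U₀ →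
      (L : ℝ) ^ 3 * (3 * (L : ℝ)) * ε₁ ≤ α L →
      ‖Bf L i V U₀‖ < 2 * ((3 : ℝ) * i.1.1.L) * ((L : ℝ) ^ 3 * ε₁))
    -- (i) CHART-112, displayed
    (hChart : ∀ (L : ℕ), 1 < L → ∀ (i : Idx L) (ε₁ : ℝ) (V : GaugeField (i.1.1.P i.1.2.1) 0 (Matrix.specialUnitaryGroup (Fin 2) ℂ))
      (U₀ : GaugeField (i.1.1.P i.1.2.2) 0 (Matrix.specialUnitaryGroup (Fin 2) ℂ)), 0 < ε₁ → PlaqSmall ε₁ V →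
      RegPr i.1.1 i.1.2.1 i.1.2.2 ((L : ℝ) ^ 3 * (3 * (L : ℝ)) * ε₁) U₀ → CloseAvg i.1.1 i.1.2.1 i.1.2.2 i.2.2.le ((L : ℝ) ^ 3 * ε₁) V U₀ → Lift L i U₀ → (L : ℝ) ^ 3 * (3 * (L : ℝ)) * ε₁ ≤ α L →
      ∀ A₁ : Space115 (i.1.1.L : ℝ) (((i.1.1.L : ℝ)⁻¹) ^ (i.1.2.2 - i.1.2.1)) (fun _ : Bond (i.1.1.P i.1.2.2).d (Pd L i) => i.1.2.2 - i.1.2.1)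
          (fun _ : Bond (i.1.1.P i.1.2.2).d (Pd L i) × Fin (i.1.1.P i.1.2.2).d => i.1.2.2 - i.1.2.1) (nabla115 (((i.1.1.L : ℝ)⁻¹) ^ (i.1.2.2 - i.1.2.1)) (fun b : Bond (i.1.1.P i.1.2.2).d (Pd L i) => unitsField (toUField U₀) ⟨(e L i).symm b.1, b.2⟩)),
        ‖A₁‖ < r L → A₁ + 𝒢f L i U₀ (Jcur (fun b : Bond (i.1.1.P i.1.2.2).d (Pd L i) => unitsField (toUField U₀) ⟨(e L i).symm b.1, b.2⟩)) + 𝒢f L i U₀ (Wf L i U₀ (A₁ + H₁f L i U₀ (Bf L i V U₀))) = 0 →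
        ∃ X : PBond (i.1.1.P i.1.2.2) 0 → Matrix (Fin 2) (Fin 2) ℂ,
          (∀ b : PBond (i.1.1.P i.1.2.2) 0, (X b).IsHermitian ∧ Matrix.trace (X b) = 0) ∧
          nMax19 i.1.1 i.1.2.1 i.1.2.2 U₀ X ≤ M L * ((L : ℝ) ^ 3 * (3 * (L : ℝ)) * ε₁) ∧
          AvgCondPrintS i.1.1 i.1.2.1 i.1.2.2 i.2.2.le V U₀ X ∧ Lan L i U₀ X ∧
          (∀ u : GaugeTransf (i.1.1.P i.1.2.2) 0 (Matrix.specialUnitaryGroup (Fin 2) ℂ), NormS i.1.1 i.1.2.1 i.1.2.2 i.2.2.le U₀ X (expHermField X) u →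
            GaugeField.gaugeAct u (emb15 U₀ (expHermField X)) ∈ fibre i.1.1 ℰp i.1.2.1 i.1.2.2 i.2.2.le V →
            ∀ γ : ℝ → GaugeField (i.1.1.P i.1.2.2) 0 (Matrix.specialUnitaryGroup (Fin 2) ℂ), γ 0 = GaugeField.gaugeAct u (emb15 U₀ (expHermField X)) →
              (∀ t, γ t ∈ fibre i.1.1 ℰp i.1.2.1 i.1.2.2 i.2.2.le V) →
              (∀ b, DifferentiableAt ℝ (fun t => ((γ t b : Matrix.specialUnitaryGroup (Fin 2) ℂ) : Matrix (Fin 2) (Fin 2) ℂ)) 0) →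
                deriv (fun t => wilsonAction4 (γ t)) 0 = 0))
    -- (ii-a) CHART_W at the critical background `W = (e^{iX}U₀)^u`: every admissible competitor has the action of a chart point `e^{iD}W`, `D` in the slice `Tsl L i W` (all size information lives in
    -- the opaque slice letter) — [Balaban1985RegularSpaces] Thm 2 + (47) at background `W` + gauge invariance of (5), DISPLAYED
    (hChartW : ∀ (L : ℕ), 1 < L → ∀ (i : Idx L) (ε₁ ε₄ : ℝ) (V : GaugeField (i.1.1.P i.1.2.1) 0 (Matrix.specialUnitaryGroup (Fin 2) ℂ))
      (U₀ : GaugeField (i.1.1.P i.1.2.2) 0 (Matrix.specialUnitaryGroup (Fin 2) ℂ)) (X : PBond (i.1.1.P i.1.2.2) 0 → Matrix (Fin 2) (Fin 2) ℂ)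
      (u : GaugeTransf (i.1.1.P i.1.2.2) 0 (Matrix.specialUnitaryGroup (Fin 2) ℂ)) (W : GaugeField (i.1.1.P i.1.2.2) 0 (Matrix.specialUnitaryGroup (Fin 2) ℂ)),
      0 < ε₁ → ε₄ ≤ 1 / 4 → ε₄ ≤ aW L → (L : ℝ) ^ 3 * (3 * (L : ℝ)) * ε₁ ≤ ε₄ → PlaqSmall ε₁ V → RegPr i.1.1 i.1.2.1 i.1.2.2 ((L : ℝ) ^ 3 * (3 * (L : ℝ)) * ε₁) U₀ →
      CloseAvg i.1.1 i.1.2.1 i.1.2.2 i.2.2.le ((L : ℝ) ^ 3 * ε₁) V U₀ → (∀ b : PBond (i.1.1.P i.1.2.2) 0, (X b).IsHermitian ∧ Matrix.trace (X b) = 0) →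
      nMax19 i.1.1 i.1.2.1 i.1.2.2 U₀ X < ε₄ → AvgCondPrintS i.1.1 i.1.2.1 i.1.2.2 i.2.2.le V U₀ X → Lan L i U₀ X →
      NormS i.1.1 i.1.2.1 i.1.2.2 i.2.2.le U₀ X (expHermField X) u → W = GaugeField.gaugeAct u (emb15 U₀ (expHermField X)) →
      W ∈ fibre i.1.1 ℰp i.1.2.1 i.1.2.2 i.2.2.le V →
      (∀ γ : ℝ → GaugeField (i.1.1.P i.1.2.2) 0 (Matrix.specialUnitaryGroup (Fin 2) ℂ), γ 0 = W → (∀ t, γ t ∈ fibre i.1.1 ℰp i.1.2.1 i.1.2.2 i.2.2.le V) →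
        (∀ b, DifferentiableAt ℝ (fun t => ((γ t b : Matrix.specialUnitaryGroup (Fin 2) ℂ) : Matrix (Fin 2) (Fin 2) ℂ)) 0) →
          deriv (fun t => wilsonAction4 (γ t)) 0 = 0) →
      ∀ X' : PBond (i.1.1.P i.1.2.2) 0 → Matrix (Fin 2) (Fin 2) ℂ, nMax19 i.1.1 i.1.2.1 i.1.2.2 U₀ X' < ε₄ →
        (∀ b : PBond (i.1.1.P i.1.2.2) 0, (X' b).IsHermitian ∧ Matrix.trace (X' b) = 0) →
          AvgCondPrint i.1.1 i.1.2.1 i.1.2.2 i.2.2.le V U₀ X' → IsLandauPrint i.1.1 i.1.2.1 i.1.2.2 U₀ X' →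
            ∃ D ∈ Tsl L i W, (∀ b : PBond (i.1.1.P i.1.2.2) 0, (D b).IsHermitian ∧ Matrix.trace (D b) = 0) ∧
              wilsonAction4 (emb15 U₀ (expHermField X')) = wilsonAction4 (emb15 W (expHermField D)))
    -- (ii-b) LOCMIN_W: `W` is a minimum of the action along the charted slice — (141)–(142) at the critical background: first variation = 0 on the linear slice, second variation
    -- `½⟨A′, Δ₁A′⟩` positive definite, third order absorbed (DISPLAYED; the α-P lane's row: TAYLOR ∧ EL_W ∧ HESS_W in their scale-aware shapes ⟹ LOCMIN_W)
    (hLocW : ∀ (L : ℕ), 1 < L → ∀ (i : Idx L) (ε₁ ε₄ : ℝ) (V : GaugeField (i.1.1.P i.1.2.1) 0 (Matrix.specialUnitaryGroup (Fin 2) ℂ))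
      (U₀ : GaugeField (i.1.1.P i.1.2.2) 0 (Matrix.specialUnitaryGroup (Fin 2) ℂ)) (X : PBond (i.1.1.P i.1.2.2) 0 → Matrix (Fin 2) (Fin 2) ℂ)
      (u : GaugeTransf (i.1.1.P i.1.2.2) 0 (Matrix.specialUnitaryGroup (Fin 2) ℂ)) (W : GaugeField (i.1.1.P i.1.2.2) 0 (Matrix.specialUnitaryGroup (Fin 2) ℂ)),
      0 < ε₁ → ε₄ ≤ 1 / 4 → ε₄ ≤ aW L → (L : ℝ) ^ 3 * (3 * (L : ℝ)) * ε₁ ≤ ε₄ → PlaqSmall ε₁ V → RegPr i.1.1 i.1.2.1 i.1.2.2 ((L : ℝ) ^ 3 * (3 * (L : ℝ)) * ε₁) U₀ →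
      CloseAvg i.1.1 i.1.2.1 i.1.2.2 i.2.2.le ((L : ℝ) ^ 3 * ε₁) V U₀ → (∀ b : PBond (i.1.1.P i.1.2.2) 0, (X b).IsHermitian ∧ Matrix.trace (X b) = 0) →
      nMax19 i.1.1 i.1.2.1 i.1.2.2 U₀ X < ε₄ → AvgCondPrintS i.1.1 i.1.2.1 i.1.2.2 i.2.2.le V U₀ X → Lan L i U₀ X →
      NormS i.1.1 i.1.2.1 i.1.2.2 i.2.2.le U₀ X (expHermField X) u → W = GaugeField.gaugeAct u (emb15 U₀ (expHermField X)) →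
      W ∈ fibre i.1.1 ℰp i.1.2.1 i.1.2.2 i.2.2.le V →
      (∀ γ : ℝ → GaugeField (i.1.1.P i.1.2.2) 0 (Matrix.specialUnitaryGroup (Fin 2) ℂ), γ 0 = W → (∀ t, γ t ∈ fibre i.1.1 ℰp i.1.2.1 i.1.2.2 i.2.2.le V) →
        (∀ b, DifferentiableAt ℝ (fun t => ((γ t b : Matrix.specialUnitaryGroup (Fin 2) ℂ) : Matrix (Fin 2) (Fin 2) ℂ)) 0) →
          deriv (fun t => wilsonAction4 (γ t)) 0 = 0) →
      ∀ D ∈ Tsl L i W, (∀ b : PBond (i.1.1.P i.1.2.2) 0, (D b).IsHermitian ∧ Matrix.trace (D b) = 0) →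
        wilsonAction4 W ≤ wilsonAction4 (emb15 W (expHermField D)))
    -- ★★OWNER RULING g28-№7 cure (ii-a): THE SYMMETRIC-CENTRE ROW `hSymCentre` (DISPLAYED; ★px14 (T1)'s `hS` bytes of record, all-`L` form at `B₃ := 3L`; supplier lineage px20 «SYM-CENTRE»):
    -- for `ε₁ ≤ aS L`, every `𝔅_k(V)` containing a printed-regular `U₀` of radius `L³·3L·ε₁` contains a printed-regular `U₁` of the same radius carrying the lift `Lift L i U₁`
    (hSymCentre : ∀ (L : ℕ), 1 < L → ∃ aS : ℝ, 0 < aS ∧ ∀ (i : Idx L) (ε₁ : ℝ), 0 < ε₁ → ε₁ ≤ aS →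
        ∀ (V : GaugeField (i.1.1.P i.1.2.1) 0 (Matrix.specialUnitaryGroup (Fin 2) ℂ)) (U₀ : GaugeField (i.1.1.P i.1.2.2) 0 (Matrix.specialUnitaryGroup (Fin 2) ℂ)),
          PlaqSmall ε₁ V → RegPr i.1.1 i.1.2.1 i.1.2.2 ((L : ℝ) ^ 3 * (3 * (L : ℝ)) * ε₁) U₀ → U₀ ∈ fibre i.1.1 ℰp i.1.2.1 i.1.2.2 i.2.2.le V →
          ∃ U₁ : GaugeField (i.1.1.P i.1.2.2) 0 (Matrix.specialUnitaryGroup (Fin 2) ℂ),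
            U₁ ∈ fibre i.1.1 ℰp i.1.2.1 i.1.2.2 i.2.2.le V ∧ RegPr i.1.1 i.1.2.1 i.1.2.2 ((L : ℝ) ^ 3 * (3 * (L : ℝ)) * ε₁) U₁ ∧ Lift L i U₁)
    -- (T2) the [B8] Thm 2 sockets AT THE SETUP-TORUS OBJECTS (`Thm2SetupSUAt`, rider dropped), one `(B₁, c₁)` per `L` — the weakest currency both consumers need
    (hThm2S : ∀ (L : ℕ), 1 < L → ∃ B₁ c₁ : ℝ, 0 < B₁ ∧ 0 < c₁ ∧ ∀ (F : T3Family), F.L = L → ∀ (n K : ℕ), n < K →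
      ∃ (β₀ B₂ : ℝ) (len : B7Prop1Explicit.Site (F.P K).d → ℝ),
        Thm2SetupSUAt (F.P K) 2 (K - n) (eta F n K) β₀ B₁ B₂ c₁ len (fun _ => True)) :
    ∀ (L : ℕ), 1 < L → ∀ (B₃ : ℝ), 4 < B₃ → ∃ a₁' O₁ : ℝ, 0 < a₁' ∧ 1 ≤ O₁ ∧
    ∀ (F : T3Family), F.L = L → ∀ (n K : ℕ) (hnK : n < K) (ε₁ : ℝ), 0 < ε₁ →
      ∀ V : GaugeField (F.P n) 0 (Matrix.specialUnitaryGroup (Fin 2) ℂ), PlaqSmall ε₁ V →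
        ∀ U₀ : GaugeField (F.P K) 0 (Matrix.specialUnitaryGroup (Fin 2) ℂ), RegPr F n K ((L : ℝ) ^ 3 * B₃ * ε₁) U₀ → U₀ ∈ fibre F ℰp n K hnK.le V →
          ε₁ ≤ a₁' → ∃ U ∈ regFibrePr F n K hnK.le (O₁ * (L : ℝ) ^ 3 * B₃ * ε₁) V,
            IsMinOn (fun W : GaugeField (F.P K) 0 (Matrix.specialUnitaryGroup (Fin 2) ℂ) => wilsonAction4 W)
              (regFibrePr F n K hnK.le (O₁ * (L : ℝ) ^ 3 * B₃ * ε₁) V) U := by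
  refine existenceMinimalOrbit_allB₃_of_one fun L hL => ?_
  have hL0 : (0 : ℝ) < (L : ℝ) := by exact_mod_cast (show 0 < L by omega)
  have hL2 : (2 : ℝ) ≤ (L : ℝ) := by exact_mod_cast (show 2 ≤ L by omega)
  have h3L4 : (4 : ℝ) < 3 * (L : ℝ) := by linarith
  obtain ⟨B₁, c₁, hB₁, hc₁, hT⟩ := hThm2S L hL
  have hCOV := cov_of_thm2SetupSUAt (L := L) (B₃ := 3 * (L : ℝ)) (by positivity) hB₁ hc₁ hT
  have hCmin := Prop7StubEXOfDisplayedRowsWWECtr.Cmin_of_P6T3_chart_locmin_pd_wWECtr hL (le_refl (3 * (L : ℝ))) (Lan L) (Lift L) (Pd L) (e L) (he L) (hB₀ L hL) (hC₄ L hL) (ha₃ L hL) (hα L hL) (hr L hL)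
    (haW L hL) (𝒢f L) (Wf L) (β L) (H₁f L) (Bf L) (Tsl L) (norm_G L hL) (prop4 L hL) (norm_H₁ L hL) (bound20 L hL) (hChart L hL)
    (hChartW L hL) (hLocW L hL)
  obtain ⟨a₁', O₁, ha₁', hO₁, H⟩ := existenceMinimalOrbit_of_CminG_covCtr hL h3L4 (Lan L) (Lift L) hCmin hCOV (hSymCentre L hL)
  exact ⟨3 * (L : ℝ), a₁', O₁, by positivity, ha₁', hO₁, H⟩

end Summit.QuantumFields.YangMills.Theorems.Prop7StubEXOfDisplayedRowsWWSECtr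

end
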